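import Literature.NumberTheory.EllipticCurves.PAdicDistributionDensity
import Literature.NumberTheory.EllipticCurves.PAdicOneVariableMahlerMasses
import HarnessLib

/-!
# The one-variable SOCKET `ν ↦ μ|_{ℤ_p^×} = (x⁻¹ · ν)|_{ℤ_p^×}` is EQUIVARIANT: if `ν' = u · (u_* ν)`
# (the measure of `u · H((1+S)^u − 1)` when `ν` is that of `H`), then `μ'|_{ℤ_p^×}(u b) = μ|_{ℤ_p^×}(b)`
# (de Shalit 1987, I.3.4 Lemma (ii): `μ_{σ(β)} = σ μ_β`)

De Shalit 1987, I.3.4 Lemma (p. 18): "(ii) `μ_{σ(β)} = σμ_β` (`σ ∈ G` acting on `ℤ_p^×` through `κ`)".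
In the tree's log-free currency (`PAdicDistributionDensity.lean`): the units lane hands over, for each
norm-coherent unit `β`, an integral series `H_β` whose distribution `ν_β = D_{H_β}` is `κ · μ_β`; moving the
unit by `σ ∈ G` replaces `H_β` by `κ(σ) · H_β ∘ [κ(σ)]` (chain rule for `D = (1+S)d/dS`), i.e. `ν_β` by
`κ(σ) · κ(σ)_* ν_β` (`PAdicOneVariableDilation.lean`: `invAmice₁_smul_μ`, `invAmice₁_binomDilate_μ`). The
Galois side (`GroupDistribution.comap` + `induce`) consumes `μ_β|_{ℤ_p^×} = restrictUnits (x⁻¹ · ν_β)` and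
needs the `U_0`-EQUIVARIANCE `μ_{σβ}|(κ(σ) b) = μ_β|(b)`. This file proves it, for an abstract pair
`ν' = u · (u_* ν)`:

* §1 plumbing on a general tower: `integral_congr_of_μ_eq`, `integral_eq_mul_of_μ_eq_mul` (integrals of
  a distribution whose masses are `c ·` those of another);
* §2 on `ℤ_p`: `unitInv_eq_inv` (`x⁻¹ · x = 1` in `𝕜`), `unitInv_units_mul` (`(ux)⁻¹ = u⁻¹ x⁻¹`),
  `cellFun_units_mul` (`𝟙_{ub}(ux) x⁻¹-bookkeeping`), **`density_unitInv_μ_of_μ_eq_mul_mulUnit`**: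
  `(x⁻¹ · ν')(u b) = (x⁻¹ · ν)(b)`, and **`restrictUnits_density_unitInv_μ_of_μ_eq_mul_mulUnit`**: the
  same for the restrictions to `ℤ_p^×` on the shifted tower — the hypothesis `hD` of
  `GroupDistribution.induce_μ_of_transLE_eq_one` read through `comap`.

Everything is a theorem; no named facts, no instances, no `sorry`.

## References

* [deShalit1987] E. de Shalit, *Iwasawa theory of elliptic curves with complex multiplication* (1987),
  I.3.4 Lemma (p. 18), II.4.5 (iv), II.4.6 (p. 59).
* [MazurTateTeitelbaum1986Invent] B. Mazur, J. Tate, J. Teitelbaum, Invent. Math. 84 (1986), §I.11.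
-/

noncomputable section

open Filter Topology
open scoped Classical

namespace Literature.NumberTheory.EllipticCurves

/-! ### §1. Integrals of distributions with proportional masses -/

namespace BoundedDistribution

variable {X : Type*} [PseudoMetricSpace X] {T : ProfiniteTower X}
variable {𝕜 : Type*} [NormedField 𝕜]

/-- Distributions with the same masses have the same integrals. [cite: MazurTateTeitelbaum1986Invent, §I.11] -/
theorem integral_congr_of_μ_eq (D D' : BoundedDistribution T 𝕜) (h : ∀ n a, D.μ n a = D'.μ n a)
    (f : X → 𝕜) : D.integral f = D'.integral f := by
  have hRS : D.riemannSum f = D'.riemannSum f := funext fun n ↦ by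
    rw [riemannSum_def, riemannSum_def]
    exact Finset.sum_congr rfl fun a _ ↦ by rw [h]
  rw [integral, integral, hRS]

variable [IsUltrametricDist 𝕜] [CompleteSpace 𝕜]

/-- **If the masses of `D'` are `c` times those of `D`, then `∫ f dD' = c ∫ f dD`** (`f` uniformly
continuous). [cite: MazurTateTeitelbaum1986Invent, §I.11] -/
theorem integral_eq_mul_of_μ_eq_mul (D D' : BoundedDistribution T 𝕜) (c : 𝕜)
    (h : ∀ n a, D'.μ n a = c * D.μ n a) {f : X → 𝕜} (hf : UniformContinuous f) :
    D'.integral f = c * D.integral f := by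
  have hRS : D'.riemannSum f = fun n ↦ c * D.riemannSum f n := funext fun n ↦ by
    rw [riemannSum_def, riemannSum_def, Finset.mul_sum]
    exact Finset.sum_congr rfl fun a _ ↦ by rw [h, mul_assoc]
  have h1 : Tendsto (D'.riemannSum f) atTop (𝓝 (c * D.integral f)) := by
    rw [hRS]; exact (D.tendsto_riemannSum_integral hf).const_mul c
  exact tendsto_nhds_unique (D'.tendsto_riemannSum_integral hf) h1

end BoundedDistribution

/-! ### §2. Equivariance of the units socket -/

section PadicUnits

variable {p : ℕ} [Fact p.Prime]
variable {𝕜 : Type*} [NormedField 𝕜] [NormedAlgebra ℚ_[p] 𝕜]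

/-- On a unit, `unitInv x` is the inverse of `x` read in `𝕜`. [cite: deShalit1987, I.3.4 (p. 18)] -/
theorem unitInv_eq_inv {x : ℤ_[p]} (h : IsUnit x) : unitInv 𝕜 x = (padicIntCast 𝕜 x)⁻¹ := by
  rw [unitInv_of_isUnit h]
  refine eq_inv_of_mul_eq_one_left ?_
  rw [← map_mul, Units.inv_mul_of_eq h.unit_spec, map_one]

/-- **`(ux)⁻¹ = u⁻¹ · x⁻¹`** for the density `unitInv` (`0 = u⁻¹ · 0` off the units).
[cite: deShalit1987, I.3.4 (p. 18)] -/
theorem unitInv_units_mul (u : ℤ_[p]ˣ) (x : ℤ_[p]) :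
    unitInv 𝕜 ((u : ℤ_[p]) * x) = padicIntCast 𝕜 ((u⁻¹ : ℤ_[p]ˣ) : ℤ_[p]) * unitInv 𝕜 x := by
  by_cases hx : IsUnit x
  · have hux : IsUnit ((u : ℤ_[p]) * x) := (Units.isUnit u).mul hx
    have hinv : padicIntCast 𝕜 ((u⁻¹ : ℤ_[p]ˣ) : ℤ_[p]) = (padicIntCast 𝕜 (u : ℤ_[p]))⁻¹ :=
      eq_inv_of_mul_eq_one_left (by rw [← map_mul, Units.inv_mul, map_one])
    rw [unitInv_eq_inv hux, unitInv_eq_inv hx, map_mul, mul_inv, hinv]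
  · have hux : ¬ IsUnit ((u : ℤ_[p]) * x) := fun h ↦ hx ((Units.isUnit_units_mul u x).mp h)
    rw [unitInv_of_not_isUnit hux, unitInv_of_not_isUnit hx, mul_zero]

/-- `ux ∈ u•b + pⁿℤ_p ↔ x ∈ b + pⁿℤ_p`. [cite: deShalit1987, I.3.4 (p. 18)] -/
theorem proj_units_mul_eq_unitMul_iff (u : ℤ_[p]ˣ) (x : ℤ_[p]) (n : ℕ) (b : ZMod (p ^ n)) :
    (ProfiniteTower.padicInt p).proj n ((u : ℤ_[p]) * x) =
        BoundedDistribution.unitMul (BoundedDistribution.unitMod n u) b ↔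
      (ProfiniteTower.padicInt p).proj n x = b := by
  rw [ProfiniteTower.padicInt_proj, ProfiniteTower.padicInt_proj, map_mul, BoundedDistribution.unitMul_def,
    BoundedDistribution.coe_unitMod]
  exact Units.mul_right_inj (BoundedDistribution.unitMod n u)

/-- `𝟙_{u•b}(ux) · (ux)⁻¹ = u⁻¹ · 𝟙_b(x) · x⁻¹`. [cite: deShalit1987, I.3.4 (p. 18)] -/
theorem cellFun_unitInv_units_mul (u : ℤ_[p]ˣ) (n : ℕ) (b : ZMod (p ^ n)) (x : ℤ_[p]) :
    BoundedDistribution.cellFun (T := ProfiniteTower.padicInt p) n (BoundedDistribution.unitMul (BoundedDistribution.unitMod n u) b)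
        (unitInv 𝕜) ((u : ℤ_[p]) * x) =
      padicIntCast 𝕜 ((u⁻¹ : ℤ_[p]ˣ) : ℤ_[p]) * BoundedDistribution.cellFun (T := ProfiniteTower.padicInt p) n b (unitInv 𝕜) x := by
  rw [BoundedDistribution.cellFun_apply, BoundedDistribution.cellFun_apply, unitInv_units_mul]
  by_cases hb : (ProfiniteTower.padicInt p).proj n x = b
  · rw [if_pos ((proj_units_mul_eq_unitMul_iff u x n b).mpr hb), if_pos hb]; ring
  · rw [if_neg (fun h ↦ hb ((proj_units_mul_eq_unitMul_iff u x n b).mp h)), if_neg hb]; ring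

variable [IsUltrametricDist 𝕜] [CompleteSpace 𝕜]

/-- **`(x⁻¹ · ν')(u•b) = (x⁻¹ · ν)(b)` when `ν' = u · (u_* ν)`** (masses of the densities by `x⁻¹`):
the `U_0`-equivariance of `β ↦ μ_β = κ⁻¹ · (κμ_β)` given that `κμ_{σβ} = κ(σ) · κ(σ)_* (κμ_β)`.
[cite: deShalit1987, I.3.4 Lemma (ii) (p. 18)] -/
theorem density_unitInv_μ_of_μ_eq_mul_mulUnit (ν ν' : BoundedDistribution (ProfiniteTower.padicInt p) 𝕜)
    (u : ℤ_[p]ˣ) (hνν' : ∀ (n : ℕ) (a : ZMod (p ^ n)), ν'.μ n a = padicIntCast 𝕜 (u : ℤ_[p]) * (ν.mulUnit u).μ n a)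
    (n : ℕ) (b : ZMod (p ^ n)) :
    (ν'.density (ProfiniteTower.padicInt_isUniform p) (unitInv 𝕜) uniformContinuous_unitInv norm_unitInv_le).μ
        n (BoundedDistribution.unitMul (BoundedDistribution.unitMod n u) b) =
      (ν.density (ProfiniteTower.padicInt_isUniform p) (unitInv 𝕜) uniformContinuous_unitInv
        norm_unitInv_le).μ n b := by
  have hcf : ∀ c : ZMod (p ^ n), UniformContinuous (BoundedDistribution.cellFun (T := ProfiniteTower.padicInt p) n c (unitInv 𝕜) :
      ℤ_[p] → 𝕜) := fun c ↦
    BoundedDistribution.uniformContinuous_cellFun (T := ProfiniteTower.padicInt p)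
      (ProfiniteTower.padicInt_isUniform p) n c
      uniformContinuous_unitInv norm_unitInv_le
  rw [BoundedDistribution.density_μ, BoundedDistribution.density_μ,
    BoundedDistribution.integral_eq_mul_of_μ_eq_mul (ν.mulUnit u) ν' _ hνν' (hcf _),
    ν.integral_mulUnit u (hcf _)]
  have hpt : (fun x ↦ BoundedDistribution.cellFun (T := ProfiniteTower.padicInt p) n (BoundedDistribution.unitMul
      (BoundedDistribution.unitMod n u) b) (unitInv 𝕜) ((u : ℤ_[p]) * x)) =
      fun x ↦ padicIntCast 𝕜 ((u⁻¹ : ℤ_[p]ˣ) : ℤ_[p]) * BoundedDistribution.cellFun (T := ProfiniteTower.padicInt p) n b (unitInv 𝕜) x :=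
    funext fun x ↦ cellFun_unitInv_units_mul u n b x
  rw [hpt, ν.integral_const_mul _ (hcf b), ← mul_assoc, ← map_mul, Units.mul_inv, map_one, one_mul]

/-- **Equivariance of the units socket `μ|_{ℤ_p^×} = restrictUnits (x⁻¹ · ν)`**: if `ν' = u · (u_* ν)`
then `μ'|_{ℤ_p^×}(u•b) = μ|_{ℤ_p^×}(b)` at every level of the shifted tower — the hypothesis `hD` of
`GroupDistribution.induce_μ_of_transLE_eq_one` (`(D (h • β)).μ n (κ(h) a) = (D β).μ n a`, `h ∈ U_0`)
read through `GroupDistribution.comap` along `κ mod p^{n+1}`. [cite: deShalit1987, I.3.4 Lemma (ii) (p. 18), II.4.6 (p. 59)] -/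
theorem restrictUnits_density_unitInv_μ_of_μ_eq_mul_mulUnit
    (ν ν' : BoundedDistribution (ProfiniteTower.padicInt p) 𝕜) (u : ℤ_[p]ˣ)
    (hνν' : ∀ (n : ℕ) (a : ZMod (p ^ n)), ν'.μ n a = padicIntCast 𝕜 (u : ℤ_[p]) * (ν.mulUnit u).μ n a)
    (n : ℕ) (b : ZMod (p ^ (n + 1))) :
    (restrictUnits (ν'.density (ProfiniteTower.padicInt_isUniform p) (unitInv 𝕜) uniformContinuous_unitInv
        norm_unitInv_le)).μ n (BoundedDistribution.unitMul (BoundedDistribution.unitMod (n + 1) u) b) =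
      (restrictUnits (ν.density (ProfiniteTower.padicInt_isUniform p) (unitInv 𝕜) uniformContinuous_unitInv
        norm_unitInv_le)).μ n b := by
  have hu : IsUnit (BoundedDistribution.unitMul (BoundedDistribution.unitMod (n + 1) u) b) ↔ IsUnit b := by
    rw [BoundedDistribution.unitMul_def]
    exact Units.isUnit_units_mul _ _
  rw [restrictUnits_μ, restrictUnits_μ, density_unitInv_μ_of_μ_eq_mul_mulUnit ν ν' u hνν']
  by_cases hb : IsUnit b
  · rw [if_pos (hu.mpr hb), if_pos hb]
  · rw [if_neg (fun h ↦ hb (hu.mp h)), if_neg hb]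

end PadicUnits

end Literature.NumberTheory.EllipticCurves

end
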